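/-
COR-CM (cell pub-hodgecm2, stage 2 of the Hodge ladder) — X_Γ-side «Albanese dictionary», morphism level: morphisms
`P_Γ → A_{(K,Ψ)}` non-zero on `H¹(−, ℚ)` versus homomorphisms `Alb(P_Γ) → A_{(K,Ψ)}` (ROUTES-B01 §7 L2-C; own-b01's
normal form `Universe.FaceAlbaneseReach`, `B01/FaceSupplyAlbanese`).  Written by the binder seat pub-hodgecm2-b10
(prover-pub-hodgecm2-b10-g17-0), count-neutral own lane (CLAIM ALBANESE-EXIST, 5), over the Literature brick
`Motives/AlbaneseHomNonvanishing`.  Theorems only; nothing cited as a record; nothing asserted; no binder row touched;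
nothing under `CorCM/B01/` (own-b01's pen) is edited, imported or restated.
-/
import Summits.HodgeConjecture.CorCM.Model.Universe
import Literature.AlgebraicGeometry.Motives.AlbaneseHomNonvanishing
import HarnessLib

/-!
# Morphisms to `A_{(K,Ψ)}` non-zero on `H¹` = non-zero homomorphisms from the Albanese (model universe)

ON THE MODEL UNIVERSE `U = Model.universeOf hHD hI hU h₃` (and the universe of record
`Model.picardCMUniverse hHD hI h₁ h₃`): for every variety `X` of the universe (in the application the realised
Picard modular surface `P_Γ = U.pms L ι₁ V Γ`), every Albanese datum `𝒥 : Jacobian (Var.scheme hU h₃ X)` (one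
exists: `Motives.nonempty_jacobian_of_isSmoothProjective_complex_of_dim`) and every CM pair `(K, Ψ)`,

  **`(∃ F : U.Mor X (U.cmAV K Ψ), U.pull F 1 ≠ 0) ↔ (∃ u : Alb X ⟶ A_{(K,Ψ)}, u ≠ 0)`**

(`exists_mor_pull_ne_zero_iff_exists_hom_ne_zero`) — the `Iff`-transport to the universe's carriers
(`U.Mor` = scheme morphisms of the realised varieties, `U.pull F 1 = (H¹(F; ℚ))` by `universeOf_pull`) of the
scheme-level dictionary `Jacobian.exists_hom_bettiCohomology_map_ne_zero_iff_exists_hom_ne_zero`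
(`Motives/AlbaneseHomNonvanishing`: `F^* = (f^P)^* ∘ u_F^*` with `u_F` the homomorphism of the universal
property, `(f^P)^*` injective on `H¹(−; ℚ)` for smooth projective `X`, and the rational representation
faithful), together with the two one-directional forms with explicit witnesses:

* `exists_hom_ne_zero_of_pull_ne_zero` — `U.pull F 1 ≠ 0 ⟹ u_F ≠ 0` (any point `P`);
* `pull_abelJacobi_comp_ne_zero` — `u ≠ 0 ⟹ U.pull (f^P ≫ u) 1 ≠ 0`;
* `forall_pull_eq_zero_iff_forall_hom_eq_zero` — every morphism `X → A_{(K,Ψ)}` kills `H¹(−; ℚ)` iff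
  `Hom(Alb X, A_{(K,Ψ)}) = 0`;
* the same three on `picardCMUniverse hHD hI h₁ h₃`.

USE (junction B01, nothing filed under `B01/`): own-b01's `Universe.faceSupply_iff_albaneseReach` /
`Universe.Uiso_ne_bot_iff` (`B01/FaceSupplyAlbanese`, rows `Fact_H1_rank`, `Fact_eigenLine`, `Fact_alphaLine`)
say B01-S ⟺ `FaceAlbaneseReach` (morphisms `P_Γ → A_{(F,ψᵢ)}` with `U.pull Fᵢ 1 ≠ 0`) and, for `σ ∈ Ψ`,
`U_Ψ(Γ)_σ ≠ 0 ⟺ ∃ F, U.pull F 1 ≠ 0`; composed with `exists_mor_pull_ne_zero_iff_exists_hom_ne_zero` they read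
**B01-S ⟺ «for every face datum, at some level `Γ`, `Hom(Alb(P_Γ), A_{(F,ψ₀)}) ≠ 0` and
`Hom(Alb(P_Γ), A_{(F,ψ₁)}) ≠ 0`»** and **`U_Ψ(Γ)_σ ≠ 0 ⟺ Hom(Alb(P_Γ), A_{(K,Ψ)}) ≠ 0`** (`σ ∈ Ψ`; no
simplicity hypothesis, sharpening `Geometry/UisoViaAlbanese`'s `Uiso_ne_bot_iff_exists_hom_ne_zero_of_isSimple`)
— the CM isogeny factors of the Albanese of the Picard modular surface (Murty–Ramakrishnan 1992; [Liu2021]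
Cor. 4.20).
-/

noncomputable section

open CategoryTheory AlgebraicGeometry

namespace Summit.HodgeConjecture.CorCM

open Literature.AlgebraicGeometry.Motives
open Literature.AlgebraicGeometry.HodgeTheory
open Literature.NumberTheory.Automorphic.PicardCM

namespace Model

section Dictionary

variable {hHD : exists_isReal_hodgeModel} {hI : hodgePQ_independent_of_hodgeModel}
  {hU : BallQuotientUniformisedDatum} {h₃ : CMAbelianVarietyRealised}
variable (X : Var) (K : CMField) (Ψ : CMType K) (𝒥 : Jacobian (Var.scheme hU h₃ X))

/-- **A morphism `F : X → A_{(K,Ψ)}` of the universe with `U.pull F 1 ≠ 0` yields a NON-ZERO homomorphism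
`Alb X → A_{(K,Ψ)}`**, namely `u_F = descPointed P (F − F(P))` (`Jacobian.descPointed_ne_zero`). -/
theorem exists_hom_ne_zero_of_pull_ne_zero (P : AlgPoints (Var.scheme hU h₃ X) ℂ)
    (F : (universeOf hHD hI hU h₃).Mor X ((universeOf hHD hI hU h₃).cmAV K Ψ))
    (hF : (universeOf hHD hI hU h₃).pull F 1 ≠ 0) :
    ∃ u : 𝒥.J ⟶ (cmRealisation h₃ (cmCode K Ψ)).AV, u ≠ 0 :=
  𝒥.exists_hom_ne_zero_of_hom_bettiCohomology_map_ne_zero P (cmRealisation h₃ (cmCode K Ψ)).AV F hF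

/-- **A non-zero homomorphism `u : Alb X → A_{(K,Ψ)}` yields the morphism `f^P ≫ u : X → A_{(K,Ψ)}` of the
universe with `U.pull (f^P ≫ u) 1 ≠ 0`** (`X` is smooth projective, `Var.isSmoothProjective`;
`Jacobian.hom_bettiCohomology_map_abelJacobi_comp_ne_zero_of_ne_zero`). -/
theorem pull_abelJacobi_comp_ne_zero (P : AlgPoints (Var.scheme hU h₃ X) ℂ)
    (u : 𝒥.J ⟶ (cmRealisation h₃ (cmCode K Ψ)).AV) (hu : u ≠ 0) :
    (universeOf hHD hI hU h₃).pull
        (show (universeOf hHD hI hU h₃).Mor X ((universeOf hHD hI hU h₃).cmAV K Ψ) from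
          𝒥.abelJacobi P ≫ u.hom.hom.hom) 1 ≠ 0 :=
  𝒥.hom_bettiCohomology_map_abelJacobi_comp_ne_zero_of_ne_zero P (cmRealisation h₃ (cmCode K Ψ)).AV
    (Var.isSmoothProjective hU h₃ X) u hu

/-- **The dictionary on the model universe**: `X` admits a morphism to `A_{(K,Ψ)}` that is non-zero on
`H¹(−; ℚ)` iff `Hom(Alb X, A_{(K,Ψ)}) ≠ 0`
(`Jacobian.exists_hom_bettiCohomology_map_ne_zero_iff_exists_hom_ne_zero`). -/
theorem exists_mor_pull_ne_zero_iff_exists_hom_ne_zero :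
    (∃ F : (universeOf hHD hI hU h₃).Mor X ((universeOf hHD hI hU h₃).cmAV K Ψ),
        (universeOf hHD hI hU h₃).pull F 1 ≠ 0) ↔
      ∃ u : 𝒥.J ⟶ (cmRealisation h₃ (cmCode K Ψ)).AV, u ≠ 0 :=
  𝒥.exists_hom_bettiCohomology_map_ne_zero_iff_exists_hom_ne_zero (cmRealisation h₃ (cmCode K Ψ)).AV
    (Var.isSmoothProjective hU h₃ X)

/-- Contrapositive form: every morphism `X → A_{(K,Ψ)}` of the universe kills `H¹(−; ℚ)` iff
`Hom(Alb X, A_{(K,Ψ)}) = 0`. -/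
theorem forall_pull_eq_zero_iff_forall_hom_eq_zero :
    (∀ F : (universeOf hHD hI hU h₃).Mor X ((universeOf hHD hI hU h₃).cmAV K Ψ),
        (universeOf hHD hI hU h₃).pull F 1 = 0) ↔
      ∀ u : 𝒥.J ⟶ (cmRealisation h₃ (cmCode K Ψ)).AV, u = 0 :=
  𝒥.forall_hom_bettiCohomology_map_eq_zero_iff_forall_hom_eq_zero (cmRealisation h₃ (cmCode K Ψ)).AV
    (Var.isSmoothProjective hU h₃ X)

end Dictionary

/-! ### On the universe of record `picardCMUniverse hHD hI h₁ h₃` -/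

section PicardCM

variable {hHD : exists_isReal_hodgeModel} {hI : hodgePQ_independent_of_hodgeModel}
  {h₁ : BallQuotientUniformised} {h₃ : CMAbelianVarietyRealised}
variable (X : Var) (K : CMField) (Ψ : CMType K)
  (𝒥 : Jacobian (Var.scheme (ballQuotientUniformisedDatum_of h₁) h₃ X))

/-- `exists_hom_ne_zero_of_pull_ne_zero` on the universe of record. -/
theorem picardCMUniverse_exists_hom_ne_zero_of_pull_ne_zero
    (P : AlgPoints (Var.scheme (ballQuotientUniformisedDatum_of h₁) h₃ X) ℂ)
    (F : (picardCMUniverse hHD hI h₁ h₃).Mor X ((picardCMUniverse hHD hI h₁ h₃).cmAV K Ψ))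
    (hF : (picardCMUniverse hHD hI h₁ h₃).pull F 1 ≠ 0) :
    ∃ u : 𝒥.J ⟶ (cmRealisation h₃ (cmCode K Ψ)).AV, u ≠ 0 :=
  exists_hom_ne_zero_of_pull_ne_zero X K Ψ 𝒥 P F hF

/-- `pull_abelJacobi_comp_ne_zero` on the universe of record. -/
theorem picardCMUniverse_pull_abelJacobi_comp_ne_zero
    (P : AlgPoints (Var.scheme (ballQuotientUniformisedDatum_of h₁) h₃ X) ℂ)
    (u : 𝒥.J ⟶ (cmRealisation h₃ (cmCode K Ψ)).AV) (hu : u ≠ 0) :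
    (picardCMUniverse hHD hI h₁ h₃).pull
        (show (picardCMUniverse hHD hI h₁ h₃).Mor X ((picardCMUniverse hHD hI h₁ h₃).cmAV K Ψ) from
          𝒥.abelJacobi P ≫ u.hom.hom.hom) 1 ≠ 0 :=
  pull_abelJacobi_comp_ne_zero X K Ψ 𝒥 P u hu

/-- **The dictionary on the universe of record**: `X` admits a morphism to `A_{(K,Ψ)}` non-zero on `H¹(−; ℚ)`
iff `Hom(Alb X, A_{(K,Ψ)}) ≠ 0`. -/
theorem picardCMUniverse_exists_mor_pull_ne_zero_iff_exists_hom_ne_zero :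
    (∃ F : (picardCMUniverse hHD hI h₁ h₃).Mor X ((picardCMUniverse hHD hI h₁ h₃).cmAV K Ψ),
        (picardCMUniverse hHD hI h₁ h₃).pull F 1 ≠ 0) ↔
      ∃ u : 𝒥.J ⟶ (cmRealisation h₃ (cmCode K Ψ)).AV, u ≠ 0 :=
  exists_mor_pull_ne_zero_iff_exists_hom_ne_zero X K Ψ 𝒥

/-- `forall_pull_eq_zero_iff_forall_hom_eq_zero` on the universe of record. -/
theorem picardCMUniverse_forall_pull_eq_zero_iff_forall_hom_eq_zero :
    (∀ F : (picardCMUniverse hHD hI h₁ h₃).Mor X ((picardCMUniverse hHD hI h₁ h₃).cmAV K Ψ),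
        (picardCMUniverse hHD hI h₁ h₃).pull F 1 = 0) ↔
      ∀ u : 𝒥.J ⟶ (cmRealisation h₃ (cmCode K Ψ)).AV, u = 0 :=
  forall_pull_eq_zero_iff_forall_hom_eq_zero X K Ψ 𝒥

end PicardCM

end Model

end Summit.HodgeConjecture.CorCM

end
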